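import Literature.NumberTheory.Sieve.GoldstonPintzYildirimThetaEuler
import Literature.NumberTheory.Sieve.GoldstonPintzYildirimTwoVarG
import HarnessLib

/-!
# Goldston–Pintz–Yıldırım, *Primes in tuples I*, §9: convergence and holomorphy of `G(s₁, s₂)`

Trunk: NumberTheory / Sieve. Continuation of `GoldstonPintzYildirimThetaEuler` (the Euler factors
`starFactor`, `starGFactor` of (9.16)–(9.19) and `GStar = ∏_p starGFactor`): the two-variable
analogue of GPY (6.9)/(7.10) for the `φ`-weighted series of §9 — "`G` is analytic and uniformly
bounded for `σ₁, σ₂ > −c`" (GPY after (9.19)). Everything here is PROVED (theorems and the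
auxiliary definitions `starW`, `gStarLog`, `starTailBound`, `gStarTail`).

* `injOn_mod_of_not_dvd_discr`, `nuStarPrime_eq_caseA_of_injOn`, `nuBarStar_eq_caseD_of_injOn`,
  `starFactor_eq_generic` — for the GENERIC primes `p ∤ Δ(H⁰)` (`H⁰ = H₁ ∪ H₂ ∪ {h₀}`; in
  particular all `p > max H⁰`) the local data are the case exponents `(a, b, d)` and the factor
  of (9.16) is `1 − W_p`, `W_p = (1 − 1/p)⁻¹ (a p^{−1−s₁} + b p^{−1−s₂} − d p^{−1−s₁−s₂})`;
* `gStarLog a b d p s₁ s₂ = log(1 − W_p) − a log(1 − p^{−1−s₁}) − b log(1 − p^{−1−s₂}) + d log(1 − p^{−1−s₁−s₂})`,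
  `exp_gStarLog` (`= starGFactor` at generic `p` beyond the threshold), and the majorant
  `norm_gStarLog_le`: `‖gStarLog‖ ≤ 7 M₀² p^{−3/2}` for `σ₁, σ₂ ≥ −1/8`, `p ≥ 16 M₀²`,
  `M₀ = a + b + d + 1` (the factors of `G` are `1 + O_M(p^{−3/2})` there);
* `hasProd_starGFactor`, `GStar_eq_prod_mul_exp`, `multipliable_starGFactor` — for
  `σ₁, σ₂ ≥ −1/8` (and the case exponents) the product converges:
  `GStar = (∏_{p ≤ T} starGFactor_p) · exp(∑_p gStarTail_p)`, `T = starTailBound`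
  (so that downstream users never meet the junk value of the `tprod`);
* `differentiableOn_GStar₂` — **`G` is jointly holomorphic on `Ω₈ = {Re s₁, Re s₂ > −1/8}`**
  (`GStarRegion ⊆ ℂ × ℂ`; several-variable Weierstrass `M`-test of
  `Literature.Analysis.Complex.LocallyUniformLimitSCV`, as for the untwisted `G` of (7.10) in
  `GoldstonPintzYildirimTwoVarG`), `continuousOn_GStar₂`, and the slices
  `differentiableOn_GStar_fst` / `differentiableOn_GStar_snd`; the symmetry `GStar_comm`
  (`(s₁, a, H₁) ↔ (s₂, b, H₂)`).

Design notes. The region `σᵢ > −1/8` (rather than the `σᵢ > −1/4` of the untwisted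
`GoldstonPintzYildirimTwoVarG`) keeps `σ₁ + σ₂ ≥ −1/4`, so that all three local terms
`p^{−1−s₁}`, `p^{−1−s₂}`, `p^{−1−s₁−s₂}` are `≤ p^{−3/4}` and ONE uniform majorant
`7(a+b+d+1)² p^{−3/2}` serves on all of `Ω₈` (no exhaustion by sub-regions); the contours of §8 lie
in `σ ≥ −c̄/log 3 > −1/100`, and the bound (7.12)/(8.3) is itself stated for `σᵢ ≥ −1/8`.

The quantitative bound `|G(s₁, s₂)| ≪ exp(C M U^{δ₁+δ₂} log log U)` ((7.12)/(8.3)) is the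
subject of the sequel.

## References

* D. A. Goldston, J. Pintz, C. Y. Yıldırım, *Primes in tuples. I*, Ann. of Math. (2) 170 (2009),
  819–862 = arXiv:math/0508185, §9 (9.16)–(9.19) and the sentence after (9.19); §6 (6.9), §7
  (7.10). [cite: GoldstonPintzYildirim2009]
-/

noncomputable section

open Finset Filter
open scoped ArithmeticFunction.Moebius ArithmeticFunction.omega Topology

namespace Literature.NumberTheory.Sieve.GPY

/-! ### Generic primes -/

/-- `p ∤ Δ(G)` makes reduction modulo `p` injective on `G` (all elements distinct mod `p`).
[cite: GoldstonPintzYildirim2009, Section 6 eq. 6.13] -/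
theorem injOn_mod_of_not_dvd_discr {G : Finset ℕ} {p : ℕ} (hΔ : ¬ p ∣ discr G) :
    Set.InjOn (fun h : ℕ => h % p) (G : Set ℕ) := by
  have h := nuPrime_eq_card_of_not_dvd hΔ
  unfold nuPrime at h
  exact Finset.card_image_iff.1 h

/-- Reduction modulo `p` is injective on `G` when all its elements are `< p`. [folklore] -/
theorem injOn_mod_of_lt {G : Finset ℕ} {p : ℕ} (hG : ∀ x ∈ G, x < p) :
    Set.InjOn (fun h : ℕ => h % p) (G : Set ℕ) := by
  intro a ha b hb h
  have h' : a % p = b % p := h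
  rwa [Nat.mod_eq_of_lt (hG a ha), Nat.mod_eq_of_lt (hG b hb)] at h'

/-- `ν*_p(G⁰) = #(G ∖ {h₀})` as soon as reduction mod `p` is injective on `G⁰ = G ∪ {h₀}`.
[cite: GoldstonPintzYildirim2009, Section 9 eq. 9.17] -/
theorem nuStarPrime_eq_caseA_of_injOn {h₀ p : ℕ} {G : Finset ℕ}
    (hinj : Set.InjOn (fun h : ℕ => h % p) (↑(insert h₀ G) : Set ℕ)) :
    nuStarPrime h₀ G p = caseA h₀ G := by
  rw [nuStarPrime, nuPrime, Finset.card_image_of_injOn hinj, caseA]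
  have hins : insert h₀ G = insert h₀ (G.erase h₀) := by
    ext x; simp only [Finset.mem_insert, Finset.mem_erase]; tauto
  rw [hins, Finset.card_insert_of_notMem (Finset.notMem_erase h₀ _)]
  omega

/-- `ν̄*_p = #((H₁ ∩ H₂) ∖ {h₀})` as soon as reduction mod `p` is injective on `H⁰`.
[cite: GoldstonPintzYildirim2009, Section 9 eq. 9.19] -/
theorem nuBarStar_eq_caseD_of_injOn {h₀ p : ℕ} {H₁ H₂ : Finset ℕ}
    (hinj : Set.InjOn (fun h : ℕ => h % p) (↑(insert h₀ (H₁ ∪ H₂)) : Set ℕ)) :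
    nuBarStar h₀ H₁ H₂ p = caseD h₀ H₁ H₂ := by
  have hset : (↑(insert h₀ (H₁ ∪ H₂)) : Set ℕ) = ↑(insert h₀ H₁) ∪ ↑(insert h₀ H₂) := by
    ext x
    simp only [Finset.coe_insert, Finset.coe_union, Set.mem_insert_iff, Set.mem_union,
      Finset.mem_coe]
    tauto
  rw [hset] at hinj
  rw [nuBarStar, nuBar_eq_card_inter, caseD,
    ← Finset.image_inter_of_injOn (insert h₀ H₁) (insert h₀ H₂) hinj,
    Finset.card_image_of_injOn (hinj.mono (by
      intro x hx
      simp only [Finset.coe_inter, Set.mem_inter_iff, Finset.mem_coe] at hx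
      exact Or.inl hx.1))]
  have hins : insert h₀ H₁ ∩ insert h₀ H₂ = insert h₀ ((H₁ ∩ H₂).erase h₀) := by
    ext x; simp only [Finset.mem_inter, Finset.mem_insert, Finset.mem_erase]; tauto
  rw [hins, Finset.card_insert_of_notMem (Finset.notMem_erase h₀ _)]
  omega

/-- GPY's `W_p`: `(1 − 1/p)⁻¹ (a p^{−1−s₁} + b p^{−1−s₂} − d p^{−1−s₁−s₂})`, so that the generic
factor of (9.16) is `1 − W_p` (`starFactor_eq_generic`).
[cite: GoldstonPintzYildirim2009, Section 9 eq. 9.16] -/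
def starW (a b d p : ℕ) (s₁ s₂ : ℂ) : ℂ :=
  (1 - (p : ℂ)⁻¹)⁻¹ * (a * (p : ℂ) ^ (-(1 + s₁)) + b * (p : ℂ) ^ (-(1 + s₂)) -
    d * (p : ℂ) ^ (-(1 + s₁ + s₂)))

/-- `1/((p − 1) p^{s}) = (1 − 1/p)⁻¹ p^{−(1+s)}` (`p ≥ 2`). [folklore] -/
theorem inv_sub_one_mul_cpow {p : ℕ} (hp : 2 ≤ p) (s : ℂ) :
    (((p : ℂ) - 1) * (p : ℂ) ^ s)⁻¹ = (1 - (p : ℂ)⁻¹)⁻¹ * (p : ℂ) ^ (-(1 + s)) := by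
  have hp0 : (p : ℂ) ≠ 0 := by exact_mod_cast (by omega : p ≠ 0)
  have hp1 : ((p : ℂ) - 1) ≠ 0 := by
    have : (1 : ℝ) < p := by exact_mod_cast hp
    exact_mod_cast (sub_ne_zero.2 (by exact_mod_cast (ne_of_gt this) : (p : ℂ) ≠ 1))
  have hps : (p : ℂ) ^ s ≠ 0 := Complex.cpow_ne_zero_iff.2 (Or.inl hp0)
  have hsplit : (p : ℂ) ^ (-(1 + s)) = (p : ℂ)⁻¹ * ((p : ℂ) ^ s)⁻¹ := by
    rw [show (-(1 + s) : ℂ) = (-1) + (-s) by ring, Complex.cpow_add _ _ hp0, Complex.cpow_neg_one,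
      Complex.cpow_neg]
  rw [hsplit]
  field_simp

/-- **The generic factor**: if reduction mod `p` is injective on `H⁰ = H₁ ∪ H₂ ∪ {h₀}` (e.g.
`p ∤ Δ(H⁰)` or `p > max H⁰`) then `starFactor = 1 − W_p` with `(a, b, d)` the case exponents.
[cite: GoldstonPintzYildirim2009, Section 9 eq. 9.16] -/
theorem starFactor_eq_generic {h₀ p : ℕ} {H₁ H₂ : Finset ℕ} (hp : 2 ≤ p)
    (hinj : Set.InjOn (fun h : ℕ => h % p) (↑(insert h₀ (H₁ ∪ H₂)) : Set ℕ)) (s₁ s₂ : ℂ) :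
    starFactor h₀ H₁ H₂ p s₁ s₂ =
      1 - starW (caseA h₀ H₁) (caseA h₀ H₂) (caseD h₀ H₁ H₂) p s₁ s₂ := by
  have h1 : Set.InjOn (fun h : ℕ => h % p) (↑(insert h₀ H₁) : Set ℕ) :=
    hinj.mono (by intro x; simp only [Finset.coe_insert, Finset.coe_union, Set.mem_insert_iff,
      Set.mem_union, Finset.mem_coe]; tauto)
  have h2 : Set.InjOn (fun h : ℕ => h % p) (↑(insert h₀ H₂) : Set ℕ) :=
    hinj.mono (by intro x; simp only [Finset.coe_insert, Finset.coe_union, Set.mem_insert_iff,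
      Set.mem_union, Finset.mem_coe]; tauto)
  rw [starFactor, nuStarPrime_eq_caseA_of_injOn h1, nuStarPrime_eq_caseA_of_injOn h2,
    nuBarStar_eq_caseD_of_injOn hinj, starW, div_eq_mul_inv, div_eq_mul_inv, div_eq_mul_inv,
    inv_sub_one_mul_cpow hp, inv_sub_one_mul_cpow hp, inv_sub_one_mul_cpow hp,
    show (-(1 + (s₁ + s₂)) : ℂ) = -(1 + s₁ + s₂) by ring]
  ring

/-! ### The logarithm of the generic factor and its majorant -/

/-- `log starGFactor` at a generic prime:
`log(1 − W_p) − a log(1 − p^{−1−s₁}) − b log(1 − p^{−1−s₂}) + d log(1 − p^{−1−s₁−s₂})`.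
[cite: GoldstonPintzYildirim2009, Section 9 eq. 9.17] -/
def gStarLog (a b d p : ℕ) (s₁ s₂ : ℂ) : ℂ :=
  Complex.log (1 - starW a b d p s₁ s₂) - a * Complex.log (1 - (p : ℂ) ^ (-(1 + s₁))) -
    b * Complex.log (1 - (p : ℂ) ^ (-(1 + s₂))) + d * Complex.log (1 - (p : ℂ) ^ (-(1 + s₁ + s₂)))

/-- For `p ≥ 2`: `‖(1 − 1/p)⁻¹‖ ≤ 2` and `‖(1 − 1/p)⁻¹ − 1‖ ≤ 2/p`. [folklore] -/
theorem norm_inv_one_sub_inv_le {p : ℕ} (hp : 2 ≤ p) :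
    ‖(1 - (p : ℂ)⁻¹)⁻¹‖ ≤ 2 ∧ ‖(1 - (p : ℂ)⁻¹)⁻¹ - 1‖ ≤ 2 / p := by
  have hp0 : (0 : ℝ) < p := by exact_mod_cast (by omega : 0 < p)
  have hp2 : (2 : ℝ) ≤ p := by exact_mod_cast hp
  have hreal : (1 - (p : ℂ)⁻¹)⁻¹ = (((p : ℝ) / ((p : ℝ) - 1) : ℝ) : ℂ) := by
    have hp1 : ((p : ℂ) - 1) ≠ 0 := by
      exact_mod_cast (sub_ne_zero.2 (by exact_mod_cast (ne_of_gt (by linarith : (1:ℝ) < p)) :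
        (p : ℂ) ≠ 1))
    have hp0' : (p : ℂ) ≠ 0 := by exact_mod_cast hp0.ne'
    push_cast
    field_simp
  have hsub : (1 - (p : ℂ)⁻¹)⁻¹ - 1 = (((1 : ℝ) / ((p : ℝ) - 1) : ℝ) : ℂ) := by
    rw [hreal, ← Complex.ofReal_one, ← Complex.ofReal_sub]
    congr 1
    have hp1 : ((p : ℝ) - 1) ≠ 0 := by linarith
    field_simp
    ring
  have hp1 : 0 < (p : ℝ) - 1 := by linarith
  constructor
  · rw [hreal, Complex.norm_real, Real.norm_eq_abs, abs_of_pos (div_pos hp0 hp1),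
      div_le_iff₀ hp1]
    linarith
  · rw [hsub, Complex.norm_real, Real.norm_eq_abs, abs_of_pos (div_pos one_pos hp1),
      div_le_div_iff₀ hp1 hp0]
    linarith

/-! ### Sizes of the local terms for `σ₁, σ₂ ≥ −1/8` -/

/-- `‖p^{−(1+s)}‖ ≤ p^{−3/4}` for `Re s ≥ −1/4` (`p ≥ 1`). [folklore] -/
theorem norm_cpow_neg_le_rpow {p : ℕ} (hp : 0 < p) {s : ℂ} (hs : -1 / 4 ≤ s.re) :
    ‖(p : ℂ) ^ (-(1 + s))‖ ≤ (p : ℝ) ^ (-(3 / 4 : ℝ)) := by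
  rw [norm_natCast_cpow_neg hp]
  exact Real.rpow_le_rpow_of_exponent_le (by exact_mod_cast hp) (by linarith)

/-- `‖p^{−(1+s₁+s₂)}‖ ≤ p^{−3/4}` for `Re sᵢ ≥ −1/8`. [folklore] -/
theorem norm_cpow_neg_add_le_rpow {p : ℕ} (hp : 0 < p) {s₁ s₂ : ℂ} (h₁ : -1 / 8 ≤ s₁.re)
    (h₂ : -1 / 8 ≤ s₂.re) : ‖(p : ℂ) ^ (-(1 + s₁ + s₂))‖ ≤ (p : ℝ) ^ (-(3 / 4 : ℝ)) := by
  rw [show (-(1 + s₁ + s₂) : ℂ) = -(1 + (s₁ + s₂)) by ring]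
  exact norm_cpow_neg_le_rpow hp (by simp only [Complex.add_re]; linarith)

/-- `p^{−3/4} ≤ 1/8` for `p ≥ 16`. [folklore] -/
theorem rpow_neg_three_quarters_le {p : ℕ} (hp : 16 ≤ p) : (p : ℝ) ^ (-(3 / 4 : ℝ)) ≤ 1 / 8 := by
  have h16 : (16 : ℝ) ≤ p := by exact_mod_cast hp
  calc (p : ℝ) ^ (-(3 / 4 : ℝ)) ≤ (16 : ℝ) ^ (-(3 / 4 : ℝ)) :=
        Real.rpow_le_rpow_of_nonpos (by norm_num) h16 (by norm_num)
    _ = 1 / 8 := by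
        rw [show (16 : ℝ) = 2 ^ (4 : ℝ) by norm_num, ← Real.rpow_mul zero_le_two]
        norm_num

/-- `‖W_p‖ ≤ 2(a + b + d) p^{−3/4}` for `Re sᵢ ≥ −1/8`, `p ≥ 2`.
[cite: GoldstonPintzYildirim2009, Section 9 eq. 9.16] -/
theorem norm_starW_le {a b d p : ℕ} (hp : 2 ≤ p) {s₁ s₂ : ℂ} (h₁ : -1 / 8 ≤ s₁.re)
    (h₂ : -1 / 8 ≤ s₂.re) :
    ‖starW a b d p s₁ s₂‖ ≤ 2 * ((a : ℝ) + b + d) * (p : ℝ) ^ (-(3 / 4 : ℝ)) := by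
  have hp0 : 0 < p := by omega
  obtain ⟨hc, -⟩ := norm_inv_one_sub_inv_le hp
  set x := (p : ℝ) ^ (-(3 / 4 : ℝ)) with hx
  have hx0 : 0 ≤ x := by positivity
  have hz₁ : ‖(p : ℂ) ^ (-(1 + s₁))‖ ≤ x := norm_cpow_neg_le_rpow hp0 (by linarith)
  have hz₂ : ‖(p : ℂ) ^ (-(1 + s₂))‖ ≤ x := norm_cpow_neg_le_rpow hp0 (by linarith)
  have hz₁₂ : ‖(p : ℂ) ^ (-(1 + s₁ + s₂))‖ ≤ x := norm_cpow_neg_add_le_rpow hp0 h₁ h₂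
  have hin : ‖(a : ℂ) * (p : ℂ) ^ (-(1 + s₁)) + b * (p : ℂ) ^ (-(1 + s₂)) -
      d * (p : ℂ) ^ (-(1 + s₁ + s₂))‖ ≤ a * x + b * x + d * x := by
    refine (norm_sub_le _ _).trans (add_le_add ((norm_add_le _ _).trans (add_le_add ?_ ?_)) ?_)
    · rw [norm_mul, Complex.norm_natCast]; exact mul_le_mul_of_nonneg_left hz₁ (Nat.cast_nonneg a)
    · rw [norm_mul, Complex.norm_natCast]; exact mul_le_mul_of_nonneg_left hz₂ (Nat.cast_nonneg b)
    · rw [norm_mul, Complex.norm_natCast]; exact mul_le_mul_of_nonneg_left hz₁₂ (Nat.cast_nonneg d)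
  unfold starW
  rw [norm_mul]
  calc ‖(1 - (p : ℂ)⁻¹)⁻¹‖ * ‖(a : ℂ) * (p : ℂ) ^ (-(1 + s₁)) + b * (p : ℂ) ^ (-(1 + s₂)) -
        d * (p : ℂ) ^ (-(1 + s₁ + s₂))‖ ≤ 2 * (a * x + b * x + d * x) :=
        mul_le_mul hc hin (norm_nonneg _) (by norm_num)
    _ = 2 * ((a : ℝ) + b + d) * x := by ring

/-- `2(a+b+d) p^{−3/4} ≤ 1/2` once `p ≥ 16 (a+b+d)²` (`p ≥ 1`). [folklore] -/
theorem two_mul_mul_rpow_le_half {a b d p : ℕ} (hp : 1 ≤ p) (hT : 16 * (a + b + d) ^ 2 ≤ p) :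
    2 * ((a : ℝ) + b + d) * (p : ℝ) ^ (-(3 / 4 : ℝ)) ≤ 1 / 2 := by
  set m : ℕ := a + b + d with hm
  have hm' : ((a : ℝ) + b + d) = m := by rw [hm]; push_cast; ring
  rw [hm']
  rcases Nat.eq_zero_or_pos m with h0 | hmpos
  · rw [h0]; simp
  have hp0 : (0 : ℝ) < p := by exact_mod_cast hp
  have hp1 : (1 : ℝ) ≤ p := by exact_mod_cast hp
  have hm1 : (1 : ℝ) ≤ m := by exact_mod_cast hmpos
  -- `p^{-3/4} ≤ p^{-1/2} = 1/√p ≤ 1/(4m)`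
  have h1 : (p : ℝ) ^ (-(3 / 4 : ℝ)) ≤ (p : ℝ) ^ (-(1 / 2 : ℝ)) :=
    Real.rpow_le_rpow_of_exponent_le hp1 (by norm_num)
  have h2 : (p : ℝ) ^ (-(1 / 2 : ℝ)) = (Real.sqrt p)⁻¹ := by
    rw [Real.rpow_neg hp0.le, Real.sqrt_eq_rpow]
  have h3 : 4 * (m : ℝ) ≤ Real.sqrt p := by
    rw [Real.le_sqrt (by positivity) hp0.le]
    have : ((16 * m ^ 2 : ℕ) : ℝ) ≤ p := by exact_mod_cast hT
    push_cast at this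
    nlinarith
  have h4 : (Real.sqrt p)⁻¹ ≤ (4 * (m : ℝ))⁻¹ := inv_anti₀ (by positivity) h3
  calc 2 * (m : ℝ) * (p : ℝ) ^ (-(3 / 4 : ℝ)) ≤ 2 * m * (4 * (m : ℝ))⁻¹ :=
        mul_le_mul_of_nonneg_left (h1.trans (h2 ▸ h4)) (by positivity)
    _ = 1 / 2 := by field_simp; ring

/-- `1 − p^{−(1+s)} ≠ 0` for `Re s > −1`, `p ≥ 2` (`|p^{−(1+s)}| < 1`). [folklore] -/
theorem one_sub_cpow_neg_ne_zero {p : ℕ} (hp : 2 ≤ p) {s : ℂ} (hs : -1 < s.re) :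
    1 - (p : ℂ) ^ (-(1 + s)) ≠ 0 := by
  have hp0 : 0 < p := by omega
  have hz1 : ‖(p : ℂ) ^ (-(1 + s))‖ < 1 := by
    rw [norm_natCast_cpow_neg hp0]
    exact Real.rpow_lt_one_of_one_lt_of_neg (by exact_mod_cast (by omega : 1 < p)) (by linarith)
  intro h0
  have : (p : ℂ) ^ (-(1 + s)) = 1 := by linear_combination -h0
  rw [this, norm_one] at hz1
  exact lt_irrefl _ hz1

/-- `exp(gStarLog) = (1 − W_p)(1 − p^{−1−s₁})^{−a}(1 − p^{−1−s₂})^{−b}(1 − p^{−1−s₁−s₂})^{d}` when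
`‖W_p‖ ≤ 1/2` and `Re sᵢ ≥ −1/8` (`p ≥ 2`). [cite: GoldstonPintzYildirim2009, Section 9 eq. 9.17] -/
theorem exp_gStarLog {a b d p : ℕ} (hp : 2 ≤ p) {s₁ s₂ : ℂ} (h₁ : -1 / 8 ≤ s₁.re)
    (h₂ : -1 / 8 ≤ s₂.re) (hW : ‖starW a b d p s₁ s₂‖ ≤ 1 / 2) :
    Complex.exp (gStarLog a b d p s₁ s₂) =
      (1 - starW a b d p s₁ s₂) * ((1 - (p : ℂ) ^ (-(1 + s₁)))⁻¹) ^ a *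
        ((1 - (p : ℂ) ^ (-(1 + s₂)))⁻¹) ^ b * (1 - (p : ℂ) ^ (-(1 + s₁ + s₂))) ^ d := by
  have hW' := one_sub_ne_zero_of_norm_le_half hW
  have hz₁ := one_sub_cpow_neg_ne_zero hp (s := s₁) (by linarith)
  have hz₂ := one_sub_cpow_neg_ne_zero hp (s := s₂) (by linarith)
  have hz₁₂ : 1 - (p : ℂ) ^ (-(1 + s₁ + s₂)) ≠ 0 := by
    rw [show (-(1 + s₁ + s₂) : ℂ) = -(1 + (s₁ + s₂)) by ring]
    exact one_sub_cpow_neg_ne_zero hp (by simp only [Complex.add_re]; linarith)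
  rw [gStarLog, Complex.exp_add, Complex.exp_sub, Complex.exp_sub, Complex.exp_nat_mul,
    Complex.exp_nat_mul, Complex.exp_nat_mul, Complex.exp_log hW', Complex.exp_log hz₁,
    Complex.exp_log hz₂, Complex.exp_log hz₁₂, div_eq_mul_inv, div_eq_mul_inv, inv_pow, inv_pow]

/-- **The factors of `G` are `1 + O_M(p^{−3/2})`**: for `p ≥ 16`, `p ≥ 16(a+b+d)²` and
`Re sᵢ ≥ −1/8`, `‖gStarLog‖ ≤ 7 (a+b+d+1)² p^{−3/2}`
(`log(1−W) = −W + O(|W|²)`, `log(1−z) = −z + O(|z|²)` by the tree's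
`Literature.NumberTheory.LFunctions.norm_neg_log_one_sub_sub_le`, and the linear terms cancel up to
`(1 − (1−1/p)⁻¹)(a z₁ + b z₂ − d z₁₂) = O((a+b+d) p^{−7/4})`).
[cite: GoldstonPintzYildirim2009, Section 9 eq. 9.17] -/
theorem norm_gStarLog_le {a b d p : ℕ} (hp : 16 ≤ p) (hT : 16 * (a + b + d) ^ 2 ≤ p) {s₁ s₂ : ℂ}
    (h₁ : -1 / 8 ≤ s₁.re) (h₂ : -1 / 8 ≤ s₂.re) :
    ‖gStarLog a b d p s₁ s₂‖ ≤ 7 * ((a : ℝ) + b + d + 1) ^ 2 * (p : ℝ) ^ (-(3 / 2 : ℝ)) := by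
  have hp2 : 2 ≤ p := by omega
  have hp0 : 0 < p := by omega
  have hp0' : (0 : ℝ) < p := by exact_mod_cast hp0
  set m : ℝ := (a : ℝ) + b + d with hm
  have hm0 : 0 ≤ m := by positivity
  set x := (p : ℝ) ^ (-(3 / 4 : ℝ)) with hx
  have hx0 : 0 ≤ x := by positivity
  have hx8 : x ≤ 1 / 8 := rpow_neg_three_quarters_le hp
  have hxx : x * x = (p : ℝ) ^ (-(3 / 2 : ℝ)) := by
    rw [hx, ← Real.rpow_add hp0']; norm_num
  set z₁ := (p : ℂ) ^ (-(1 + s₁)) with hz₁def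
  set z₂ := (p : ℂ) ^ (-(1 + s₂)) with hz₂def
  set z₁₂ := (p : ℂ) ^ (-(1 + s₁ + s₂)) with hz₁₂def
  set c := (1 - (p : ℂ)⁻¹)⁻¹ with hcdef
  set W := starW a b d p s₁ s₂ with hWdef
  have hz₁ : ‖z₁‖ ≤ x := norm_cpow_neg_le_rpow hp0 (by linarith)
  have hz₂ : ‖z₂‖ ≤ x := norm_cpow_neg_le_rpow hp0 (by linarith)
  have hz₁₂ : ‖z₁₂‖ ≤ x := norm_cpow_neg_add_le_rpow hp0 h₁ h₂
  have hW : ‖W‖ ≤ 2 * m * x := norm_starW_le hp2 h₁ h₂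
  have hWhalf : ‖W‖ ≤ 1 / 2 := hW.trans (two_mul_mul_rpow_le_half (by omega) hT)
  obtain ⟨hc, hc1⟩ := norm_inv_one_sub_inv_le hp2
  have hzhalf : ∀ {z : ℂ}, ‖z‖ ≤ x → ‖z‖ ≤ 1 / 2 := fun hz => hz.trans (by linarith)
  -- the four logarithmic remainders
  have eW : ‖Complex.log (1 - W) + W‖ ≤ ‖W‖ ^ 2 := by
    rw [show Complex.log (1 - W) + W = -(-Complex.log (1 - W) - W) by ring, norm_neg]
    exact Literature.NumberTheory.LFunctions.norm_neg_log_one_sub_sub_le hWhalf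
  have eZ : ∀ {z : ℂ}, ‖z‖ ≤ x → ‖Complex.log (1 - z) + z‖ ≤ x ^ 2 := fun {z} hz => by
    rw [show Complex.log (1 - z) + z = -(-Complex.log (1 - z) - z) by ring, norm_neg]
    exact (Literature.NumberTheory.LFunctions.norm_neg_log_one_sub_sub_le (hzhalf hz)).trans
      (pow_le_pow_left₀ (norm_nonneg _) hz 2)
  -- the linear terms: `−W + a z₁ + b z₂ − d z₁₂ = −(c − 1)(a z₁ + b z₂ − d z₁₂)`
  have hlin : -W + a * z₁ + b * z₂ - d * z₁₂ = -((c - 1) * (a * z₁ + b * z₂ - d * z₁₂)) := by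
    rw [hWdef, starW]
    ring
  have hin' : ‖(a : ℂ) * z₁ + b * z₂ - d * z₁₂‖ ≤ a * x + b * x + d * x := by
    refine (norm_sub_le _ _).trans (add_le_add ((norm_add_le _ _).trans (add_le_add ?_ ?_)) ?_)
    · rw [norm_mul, Complex.norm_natCast]; exact mul_le_mul_of_nonneg_left hz₁ (Nat.cast_nonneg a)
    · rw [norm_mul, Complex.norm_natCast]; exact mul_le_mul_of_nonneg_left hz₂ (Nat.cast_nonneg b)
    · rw [norm_mul, Complex.norm_natCast]; exact mul_le_mul_of_nonneg_left hz₁₂ (Nat.cast_nonneg d)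
  have hin : ‖(a : ℂ) * z₁ + b * z₂ - d * z₁₂‖ ≤ m * x := by
    refine hin'.trans (le_of_eq ?_)
    rw [hm]; ring
  have elin : ‖-W + a * z₁ + b * z₂ - d * z₁₂‖ ≤ 2 / p * (m * x) := by
    rw [hlin, norm_neg, norm_mul]
    exact mul_le_mul hc1 hin (norm_nonneg _) (by positivity)
  -- decomposition of `gStarLog`
  have hdec : gStarLog a b d p s₁ s₂ =
      (Complex.log (1 - W) + W) - a * (Complex.log (1 - z₁) + z₁) - b * (Complex.log (1 - z₂) + z₂) +
        d * (Complex.log (1 - z₁₂) + z₁₂) + (-W + a * z₁ + b * z₂ - d * z₁₂) := by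
    rw [gStarLog]; ring
  rw [hdec]
  have hna : ‖(a : ℂ) * (Complex.log (1 - z₁) + z₁)‖ ≤ a * x ^ 2 := by
    rw [norm_mul, Complex.norm_natCast]; exact mul_le_mul_of_nonneg_left (eZ hz₁) (Nat.cast_nonneg a)
  have hnb : ‖(b : ℂ) * (Complex.log (1 - z₂) + z₂)‖ ≤ b * x ^ 2 := by
    rw [norm_mul, Complex.norm_natCast]; exact mul_le_mul_of_nonneg_left (eZ hz₂) (Nat.cast_nonneg b)
  have hnd : ‖(d : ℂ) * (Complex.log (1 - z₁₂) + z₁₂)‖ ≤ d * x ^ 2 := by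
    rw [norm_mul, Complex.norm_natCast]; exact mul_le_mul_of_nonneg_left (eZ hz₁₂) (Nat.cast_nonneg d)
  have hW2 : ‖W‖ ^ 2 ≤ (2 * m * x) ^ 2 := pow_le_pow_left₀ (norm_nonneg _) hW 2
  have hp2x : 2 / (p : ℝ) ≤ 2 * x := by
    -- `1/p ≤ p^{-3/4}`
    rw [div_eq_mul_inv]
    refine mul_le_mul_of_nonneg_left ?_ (by norm_num)
    rw [hx, ← Real.rpow_neg_one]
    exact Real.rpow_le_rpow_of_exponent_le (by exact_mod_cast (by omega : 1 ≤ p)) (by norm_num)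
  calc ‖(Complex.log (1 - W) + W) - a * (Complex.log (1 - z₁) + z₁) - b * (Complex.log (1 - z₂) + z₂) +
        d * (Complex.log (1 - z₁₂) + z₁₂) + (-W + a * z₁ + b * z₂ - d * z₁₂)‖
      ≤ ‖W‖ ^ 2 + a * x ^ 2 + b * x ^ 2 + d * x ^ 2 + 2 / p * (m * x) := by
        refine (norm_add_le _ _).trans (add_le_add ?_ elin)
        refine (norm_add_le _ _).trans (add_le_add ?_ hnd)
        refine (norm_sub_le _ _).trans (add_le_add ?_ hnb)
        exact (norm_sub_le _ _).trans (add_le_add eW hna)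
    _ ≤ (2 * m * x) ^ 2 + m * x ^ 2 + (2 * x) * (m * x) := by
        have : (a : ℝ) * x ^ 2 + b * x ^ 2 + d * x ^ 2 = m * x ^ 2 := by rw [hm]; ring
        nlinarith [mul_le_mul_of_nonneg_right hp2x (mul_nonneg hm0 hx0)]
    _ = (4 * m ^ 2 + 3 * m) * (x * x) := by ring
    _ ≤ 7 * (m + 1) ^ 2 * (x * x) := by
        refine mul_le_mul_of_nonneg_right ?_ (by positivity)
        nlinarith
    _ = 7 * ((a : ℝ) + b + d + 1) ^ 2 * (p : ℝ) ^ (-(3 / 2 : ℝ)) := by rw [hxx]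

/-! ### The tail of the product: `p > T` -/

/-- The threshold beyond which the primes are generic (`p > max H⁰`) and the logarithmic expansion
applies (`p ≥ 16`, `p ≥ 16(a+b+d)²`): `T = max(max H⁰, 16, 16(a+b+d)²)` with the case exponents.
[cite: GoldstonPintzYildirim2009, Section 9 eq. 9.17] -/
def starTailBound (h₀ : ℕ) (H₁ H₂ : Finset ℕ) : ℕ :=
  max (max ((insert h₀ (H₁ ∪ H₂)).sup id) 16)
    (16 * (caseA h₀ H₁ + caseA h₀ H₂ + caseD h₀ H₁ H₂) ^ 2)

/-- Beyond the threshold every element of `H⁰` is `< p`. [folklore] -/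
theorem lt_of_starTailBound_lt {h₀ : ℕ} {H₁ H₂ : Finset ℕ} {p : ℕ}
    (hp : starTailBound h₀ H₁ H₂ < p) : ∀ x ∈ insert h₀ (H₁ ∪ H₂), x < p :=
  fun _ hx => lt_of_le_of_lt (Finset.le_sup (f := id) hx)
    (((le_max_left _ _).trans (le_max_left _ _)).trans_lt hp)

/-- Beyond the threshold `p ≥ 16`. [folklore] -/
theorem sixteen_le_of_starTailBound_lt {h₀ : ℕ} {H₁ H₂ : Finset ℕ} {p : ℕ}
    (hp : starTailBound h₀ H₁ H₂ < p) : 16 ≤ p :=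
  (((le_max_right _ _).trans (le_max_left _ _)).trans_lt hp).le

/-- Beyond the threshold `p ≥ 16(a+b+d)²`. [folklore] -/
theorem sq_le_of_starTailBound_lt {h₀ : ℕ} {H₁ H₂ : Finset ℕ} {p : ℕ}
    (hp : starTailBound h₀ H₁ H₂ < p) :
    16 * (caseA h₀ H₁ + caseA h₀ H₂ + caseD h₀ H₁ H₂) ^ 2 ≤ p :=
  ((le_max_right _ _).trans_lt hp).le

/-- For `p > T` and `Re sᵢ ≥ −1/8` the factor of `G` (case exponents) is `exp(gStarLog)`.
[cite: GoldstonPintzYildirim2009, Section 9 eq. 9.17] -/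
theorem starGFactor_eq_exp_gStarLog {h₀ : ℕ} {H₁ H₂ : Finset ℕ} {p : ℕ}
    (hp : starTailBound h₀ H₁ H₂ < p) {s₁ s₂ : ℂ} (h₁ : -1 / 8 ≤ s₁.re) (h₂ : -1 / 8 ≤ s₂.re) :
    starGFactor h₀ H₁ H₂ (caseA h₀ H₁) (caseA h₀ H₂) (caseD h₀ H₁ H₂) p s₁ s₂ =
      Complex.exp (gStarLog (caseA h₀ H₁) (caseA h₀ H₂) (caseD h₀ H₁ H₂) p s₁ s₂) := by
  have hp16 := sixteen_le_of_starTailBound_lt hp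
  have hp2 : 2 ≤ p := by omega
  have hinj : Set.InjOn (fun h : ℕ => h % p) (↑(insert h₀ (H₁ ∪ H₂)) : Set ℕ) :=
    injOn_mod_of_lt (lt_of_starTailBound_lt hp)
  have hW : ‖starW (caseA h₀ H₁) (caseA h₀ H₂) (caseD h₀ H₁ H₂) p s₁ s₂‖ ≤ 1 / 2 :=
    (norm_starW_le hp2 h₁ h₂).trans (two_mul_mul_rpow_le_half (by omega) (sq_le_of_starTailBound_lt hp))
  rw [exp_gStarLog hp2 h₁ h₂ hW, starGFactor, starFactor_eq_generic hp2 hinj]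

/-- The logarithms of the tail factors of `G` (`0` for `p ≤ T`).
[cite: GoldstonPintzYildirim2009, Section 9 eq. 9.17] -/
def gStarTail (h₀ : ℕ) (H₁ H₂ : Finset ℕ) (p : Nat.Primes) (s₁ s₂ : ℂ) : ℂ :=
  if (p : ℕ) ≤ starTailBound h₀ H₁ H₂ then 0
  else gStarLog (caseA h₀ H₁) (caseA h₀ H₂) (caseD h₀ H₁ H₂) p s₁ s₂

/-- The size constant `7 (a + b + d + 1)²` of the tail majorant.
[cite: GoldstonPintzYildirim2009, Section 9 eq. 9.17] -/
def starTailConst (h₀ : ℕ) (H₁ H₂ : Finset ℕ) : ℝ :=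
  7 * ((caseA h₀ H₁ : ℝ) + caseA h₀ H₂ + caseD h₀ H₁ H₂ + 1) ^ 2

/-- Uniform majorant on `Re sᵢ ≥ −1/8`: `‖gStarTail p‖ ≤ 7(a+b+d+1)² p^{−3/2}`.
[cite: GoldstonPintzYildirim2009, Section 9 eq. 9.17] -/
theorem norm_gStarTail_le {h₀ : ℕ} {H₁ H₂ : Finset ℕ} {s₁ s₂ : ℂ} (h₁ : -1 / 8 ≤ s₁.re)
    (h₂ : -1 / 8 ≤ s₂.re) (p : Nat.Primes) :
    ‖gStarTail h₀ H₁ H₂ p s₁ s₂‖ ≤ starTailConst h₀ H₁ H₂ * (p : ℝ) ^ (-(3 / 2 : ℝ)) := by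
  unfold gStarTail starTailConst
  split_ifs with hp
  · rw [norm_zero]; positivity
  · rw [not_le] at hp
    exact norm_gStarLog_le (sixteen_le_of_starTailBound_lt hp) (sq_le_of_starTailBound_lt hp) h₁ h₂

/-- `∑_p 7(a+b+d+1)² p^{−3/2} < ∞`. [folklore] -/
theorem summable_starTail_majorant (h₀ : ℕ) (H₁ H₂ : Finset ℕ) :
    Summable fun p : Nat.Primes => starTailConst h₀ H₁ H₂ * (p : ℝ) ^ (-(3 / 2 : ℝ)) :=
  (Nat.Primes.summable_rpow.2 (by norm_num)).mul_left _

/-- `∑_p gStarTail_p(s₁, s₂)` converges absolutely for `Re sᵢ ≥ −1/8`.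
[cite: GoldstonPintzYildirim2009, Section 9 eq. 9.17] -/
theorem summable_gStarTail {h₀ : ℕ} {H₁ H₂ : Finset ℕ} {s₁ s₂ : ℂ} (h₁ : -1 / 8 ≤ s₁.re)
    (h₂ : -1 / 8 ≤ s₂.re) : Summable fun p : Nat.Primes => gStarTail h₀ H₁ H₂ p s₁ s₂ :=
  Summable.of_norm_bounded (summable_starTail_majorant h₀ H₁ H₂) (fun p => norm_gStarTail_le h₁ h₂ p)

/-- **Convergence of the Euler product of `G`** (GPY: "`G` is analytic and uniformly bounded for
`σ₁, σ₂ > −c`"): for `Re sᵢ ≥ −1/8` and the case exponents,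
`∏_p starGFactor_p = (∏_{p ≤ T} starGFactor_p) · exp(∑_p gStarTail_p)` as a `HasProd`.
[cite: GoldstonPintzYildirim2009, Section 9 eq. 9.17] -/
theorem hasProd_starGFactor {h₀ : ℕ} {H₁ H₂ : Finset ℕ} {s₁ s₂ : ℂ} (h₁ : -1 / 8 ≤ s₁.re)
    (h₂ : -1 / 8 ≤ s₂.re) :
    HasProd (fun p : Nat.Primes =>
        starGFactor h₀ H₁ H₂ (caseA h₀ H₁) (caseA h₀ H₂) (caseD h₀ H₁ H₂) p s₁ s₂)
      ((∏ p ∈ smallPrimes (starTailBound h₀ H₁ H₂),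
          starGFactor h₀ H₁ H₂ (caseA h₀ H₁) (caseA h₀ H₂) (caseD h₀ H₁ H₂) p s₁ s₂) *
        Complex.exp (∑' p : Nat.Primes, gStarTail h₀ H₁ H₂ p s₁ s₂)) := by
  set B := starTailBound h₀ H₁ H₂ with hB
  set F : Nat.Primes → ℂ := fun p =>
    starGFactor h₀ H₁ H₂ (caseA h₀ H₁) (caseA h₀ H₂) (caseD h₀ H₁ H₂) p s₁ s₂ with hF
  have hA : HasProd (fun p : Nat.Primes => if (p : ℕ) ≤ B then F p else 1)
      (∏ p ∈ smallPrimes B, F p) := by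
    have h : HasProd (fun p : Nat.Primes => if (p : ℕ) ≤ B then F p else 1)
        (∏ p ∈ smallPrimes B, (if (p : ℕ) ≤ B then F p else 1)) :=
      hasProd_prod_of_ne_finset_one (fun p hp => if_neg (mt mem_smallPrimes.2 hp))
    rwa [Finset.prod_congr rfl (fun p hp => if_pos (mem_smallPrimes.1 hp))] at h
  have hE : HasProd (fun p : Nat.Primes => Complex.exp (gStarTail h₀ H₁ H₂ p s₁ s₂))
      (Complex.exp (∑' p : Nat.Primes, gStarTail h₀ H₁ H₂ p s₁ s₂)) :=
    (summable_gStarTail h₁ h₂).hasSum.cexp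
  have h := hA.mul hE
  convert h using 1
  funext p
  by_cases hp : (p : ℕ) ≤ B
  · simp [gStarTail, ← hB, hp, hF]
  · rw [if_neg hp, one_mul, gStarTail, ← hB, if_neg hp, hF]
    exact starGFactor_eq_exp_gStarLog (not_le.1 hp) h₁ h₂

/-- `G = (∏_{p ≤ T} starGFactor_p) · exp(∑_p gStarTail_p)` for `Re sᵢ ≥ −1/8`.
[cite: GoldstonPintzYildirim2009, Section 9 eq. 9.17] -/
theorem GStar_eq_prod_mul_exp {h₀ : ℕ} {H₁ H₂ : Finset ℕ} {s₁ s₂ : ℂ} (h₁ : -1 / 8 ≤ s₁.re)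
    (h₂ : -1 / 8 ≤ s₂.re) :
    GStar h₀ H₁ H₂ (caseA h₀ H₁) (caseA h₀ H₂) (caseD h₀ H₁ H₂) s₁ s₂ =
      (∏ p ∈ smallPrimes (starTailBound h₀ H₁ H₂),
          starGFactor h₀ H₁ H₂ (caseA h₀ H₁) (caseA h₀ H₂) (caseD h₀ H₁ H₂) p s₁ s₂) *
        Complex.exp (∑' p : Nat.Primes, gStarTail h₀ H₁ H₂ p s₁ s₂) :=
  (hasProd_starGFactor h₁ h₂).tprod_eq

/-- The Euler product of `G` converges for `Re sᵢ ≥ −1/8`.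
[cite: GoldstonPintzYildirim2009, Section 9 eq. 9.17] -/
theorem multipliable_starGFactor {h₀ : ℕ} {H₁ H₂ : Finset ℕ} {s₁ s₂ : ℂ} (h₁ : -1 / 8 ≤ s₁.re)
    (h₂ : -1 / 8 ≤ s₂.re) :
    Multipliable fun p : Nat.Primes =>
      starGFactor h₀ H₁ H₂ (caseA h₀ H₁) (caseA h₀ H₂) (caseD h₀ H₁ H₂) p s₁ s₂ :=
  ⟨_, hasProd_starGFactor h₁ h₂⟩

/-! ### Joint holomorphy on `Ω₈ = {Re s₁, Re s₂ > −1/8}` -/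

/-- The region `Ω₈ = {(s₁, s₂) : Re s₁ > −1/8, Re s₂ > −1/8} ⊆ ℂ × ℂ`.
[cite: GoldstonPintzYildirim2009, Section 9 eq. 9.17] -/
def GStarRegion : Set (ℂ × ℂ) := {z | -1 / 8 < z.1.re ∧ -1 / 8 < z.2.re}

/-- `Ω₈` is open. [folklore] -/
theorem isOpen_GStarRegion : IsOpen GStarRegion :=
  (isOpen_lt continuous_const (Complex.continuous_re.comp continuous_fst)).inter
    (isOpen_lt continuous_const (Complex.continuous_re.comp continuous_snd))

/-- `(p − 1) p^{w} ≠ 0` for `p ≥ 2`. [folklore] -/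
theorem sub_one_mul_cpow_ne_zero {p : ℕ} (hp : 2 ≤ p) (w : ℂ) : ((p : ℂ) - 1) * (p : ℂ) ^ w ≠ 0 := by
  have hp0 : (p : ℂ) ≠ 0 := by exact_mod_cast (by omega : p ≠ 0)
  refine mul_ne_zero ?_ (Complex.cpow_ne_zero_iff.2 (Or.inl hp0))
  have : (1 : ℝ) < p := by exact_mod_cast (by omega : 1 < p)
  exact_mod_cast (sub_ne_zero.2 (by exact_mod_cast (ne_of_gt this) : (p : ℂ) ≠ 1))

/-- The Euler factor of (9.16) is entire on `ℂ × ℂ` (`p ≥ 2`).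
[cite: GoldstonPintzYildirim2009, Section 9 eq. 9.16] -/
theorem differentiableAt_starFactor₂ (h₀ : ℕ) (H₁ H₂ : Finset ℕ) {p : ℕ} (hp : 2 ≤ p) (z : ℂ × ℂ) :
    DifferentiableAt ℂ (fun z : ℂ × ℂ => starFactor h₀ H₁ H₂ p z.1 z.2) z := by
  have hp0 : (p : ℂ) ≠ 0 := by exact_mod_cast (by omega : p ≠ 0)
  have d1 : DifferentiableAt ℂ (fun z : ℂ × ℂ => (p : ℂ) ^ z.1) z :=
    differentiableAt_fst.const_cpow (Or.inl hp0)
  have d2 : DifferentiableAt ℂ (fun z : ℂ × ℂ => (p : ℂ) ^ z.2) z :=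
    differentiableAt_snd.const_cpow (Or.inl hp0)
  have d3 : DifferentiableAt ℂ (fun z : ℂ × ℂ => (p : ℂ) ^ (z.1 + z.2)) z :=
    (differentiableAt_fst.add differentiableAt_snd).const_cpow (Or.inl hp0)
  have m1 : DifferentiableAt ℂ (fun z : ℂ × ℂ => ((p : ℂ) - 1) * (p : ℂ) ^ z.1) z :=
    (differentiableAt_const _).mul d1
  have m2 : DifferentiableAt ℂ (fun z : ℂ × ℂ => ((p : ℂ) - 1) * (p : ℂ) ^ z.2) z :=
    (differentiableAt_const _).mul d2
  have m3 : DifferentiableAt ℂ (fun z : ℂ × ℂ => ((p : ℂ) - 1) * (p : ℂ) ^ (z.1 + z.2)) z :=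
    (differentiableAt_const _).mul d3
  have e1 : DifferentiableAt ℂ (fun z : ℂ × ℂ =>
      (nuStarPrime h₀ H₁ p : ℂ) * (((p : ℂ) - 1) * (p : ℂ) ^ z.1)⁻¹) z :=
    (differentiableAt_const _).mul (m1.inv (sub_one_mul_cpow_ne_zero hp z.1))
  have e2 : DifferentiableAt ℂ (fun z : ℂ × ℂ =>
      (nuStarPrime h₀ H₂ p : ℂ) * (((p : ℂ) - 1) * (p : ℂ) ^ z.2)⁻¹) z :=
    (differentiableAt_const _).mul (m2.inv (sub_one_mul_cpow_ne_zero hp z.2))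
  have e3 : DifferentiableAt ℂ (fun z : ℂ × ℂ =>
      (nuBarStar h₀ H₁ H₂ p : ℂ) * (((p : ℂ) - 1) * (p : ℂ) ^ (z.1 + z.2))⁻¹) z :=
    (differentiableAt_const _).mul (m3.inv (sub_one_mul_cpow_ne_zero hp (z.1 + z.2)))
  unfold starFactor
  simp only [div_eq_mul_inv]
  exact (((differentiableAt_const _).sub e1).sub e2).add e3

/-- Each factor of `G` is differentiable on `ℂ × ℂ` where `Re z₁, Re z₂ > −1` (`p ≥ 2`).
[cite: GoldstonPintzYildirim2009, Section 9 eq. 9.17] -/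
theorem differentiableAt_starGFactor₂ (h₀ : ℕ) (H₁ H₂ : Finset ℕ) (a b d : ℕ) {p : ℕ} (hp : 2 ≤ p)
    {z : ℂ × ℂ} (h1 : -1 < z.1.re) (h2 : -1 < z.2.re) :
    DifferentiableAt ℂ (fun z : ℂ × ℂ => starGFactor h₀ H₁ H₂ a b d p z.1 z.2) z := by
  have hp0 : 0 < p := by omega
  have hF := differentiableAt_starFactor₂ h₀ H₁ H₂ hp z
  have hx := differentiableAt_cpow_neg_fst hp0 z
  have hy := differentiableAt_cpow_neg_snd hp0 z
  have hxy := differentiableAt_cpow_neg_add hp0 z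
  have hz₁ := one_sub_cpow_neg_ne_zero hp h1
  have hz₂ := one_sub_cpow_neg_ne_zero hp h2
  unfold starGFactor
  exact ((hF.mul ((((differentiableAt_const _).sub hx).inv hz₁).pow _)).mul
    ((((differentiableAt_const _).sub hy).inv hz₂).pow _)).mul (((differentiableAt_const _).sub hxy).pow _)

/-- `W_p` is entire on `ℂ × ℂ` (`p ≥ 1`). [cite: GoldstonPintzYildirim2009, Section 9 eq. 9.16] -/
theorem differentiableAt_starW₂ (a b d : ℕ) {p : ℕ} (hp : 0 < p) (z : ℂ × ℂ) :
    DifferentiableAt ℂ (fun z : ℂ × ℂ => starW a b d p z.1 z.2) z := by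
  have hx := differentiableAt_cpow_neg_fst hp z
  have hy := differentiableAt_cpow_neg_snd hp z
  have hxy := differentiableAt_cpow_neg_add hp z
  unfold starW
  exact (differentiableAt_const _).mul (((hx.const_mul _).add (hy.const_mul _)).sub (hxy.const_mul _))

/-- `gStarLog p` is differentiable at `z` once `‖W_p‖, ‖p^{−1−z₁}‖, ‖p^{−1−z₂}‖, ‖p^{−1−z₁−z₂}‖ ≤ 1/2`
(all logarithms stay in the right half-plane). [cite: GoldstonPintzYildirim2009, Section 9 eq. 9.17] -/
theorem differentiableAt_gStarLog₂ {a b d p : ℕ} (hp : 0 < p) {z : ℂ × ℂ}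
    (hW : ‖starW a b d p z.1 z.2‖ ≤ 1 / 2) (hx : ‖(p : ℂ) ^ (-(1 + z.1))‖ ≤ 1 / 2)
    (hy : ‖(p : ℂ) ^ (-(1 + z.2))‖ ≤ 1 / 2) (hxy : ‖(p : ℂ) ^ (-(1 + z.1 + z.2))‖ ≤ 1 / 2) :
    DifferentiableAt ℂ (fun z : ℂ × ℂ => gStarLog a b d p z.1 z.2) z := by
  have dW := differentiableAt_starW₂ a b d hp z
  have dx := differentiableAt_cpow_neg_fst hp z
  have dy := differentiableAt_cpow_neg_snd hp z
  have dxy := differentiableAt_cpow_neg_add hp z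
  unfold gStarLog
  refine (((((differentiableAt_const _).sub dW).clog ?_).sub
    ((((differentiableAt_const _).sub dx).clog ?_).const_mul _)).sub
    ((((differentiableAt_const _).sub dy).clog ?_).const_mul _)).add
    ((((differentiableAt_const _).sub dxy).clog ?_).const_mul _)
  · exact Complex.mem_slitPlane_iff.2 (Or.inl (re_one_sub_pos_of_norm_le_half hW))
  · exact Complex.mem_slitPlane_iff.2 (Or.inl (re_one_sub_pos_of_norm_le_half hx))
  · exact Complex.mem_slitPlane_iff.2 (Or.inl (re_one_sub_pos_of_norm_le_half hy))
  · exact Complex.mem_slitPlane_iff.2 (Or.inl (re_one_sub_pos_of_norm_le_half hxy))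

/-- Each `gStarTail p` is differentiable on `Ω₈`.
[cite: GoldstonPintzYildirim2009, Section 9 eq. 9.17] -/
theorem differentiableOn_gStarTail₂ (h₀ : ℕ) (H₁ H₂ : Finset ℕ) (p : Nat.Primes) :
    DifferentiableOn ℂ (fun z : ℂ × ℂ => gStarTail h₀ H₁ H₂ p z.1 z.2) GStarRegion := by
  intro z hz
  have h₁ : -1 / 8 ≤ z.1.re := le_of_lt hz.1
  have h₂ : -1 / 8 ≤ z.2.re := le_of_lt hz.2
  by_cases hp : (p : ℕ) ≤ starTailBound h₀ H₁ H₂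
  · have : (fun z : ℂ × ℂ => gStarTail h₀ H₁ H₂ p z.1 z.2) = fun _ => 0 := funext fun _ => if_pos hp
    rw [this]
    exact (differentiableAt_const _).differentiableWithinAt
  · have heq : (fun z : ℂ × ℂ => gStarTail h₀ H₁ H₂ p z.1 z.2) =
        fun z => gStarLog (caseA h₀ H₁) (caseA h₀ H₂) (caseD h₀ H₁ H₂) p z.1 z.2 :=
      funext fun _ => if_neg hp
    rw [heq]
    rw [not_le] at hp
    have hp16 := sixteen_le_of_starTailBound_lt hp
    have hp2 : 2 ≤ (p : ℕ) := by omega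
    have hp0 : 0 < (p : ℕ) := p.2.pos
    have hx8 := rpow_neg_three_quarters_le hp16
    have hW : ‖starW (caseA h₀ H₁) (caseA h₀ H₂) (caseD h₀ H₁ H₂) p z.1 z.2‖ ≤ 1 / 2 :=
      (norm_starW_le hp2 h₁ h₂).trans (two_mul_mul_rpow_le_half (by omega) (sq_le_of_starTailBound_lt hp))
    have hx : ‖((p : ℕ) : ℂ) ^ (-(1 + z.1))‖ ≤ 1 / 2 :=
      (norm_cpow_neg_le_rpow hp0 (by linarith)).trans (by linarith)
    have hy : ‖((p : ℕ) : ℂ) ^ (-(1 + z.2))‖ ≤ 1 / 2 :=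
      (norm_cpow_neg_le_rpow hp0 (by linarith)).trans (by linarith)
    have hxy : ‖((p : ℕ) : ℂ) ^ (-(1 + z.1 + z.2))‖ ≤ 1 / 2 :=
      (norm_cpow_neg_add_le_rpow hp0 h₁ h₂).trans (by linarith)
    exact (differentiableAt_gStarLog₂ hp0 hW hx hy hxy).differentiableWithinAt

/-- **`G` is jointly holomorphic on `Ω₈ = {Re s₁, Re s₂ > −1/8}`** (as a map on `ℂ × ℂ`; case
exponents): a finite product of holomorphic factors times `exp` of a normally convergent series of
holomorphic maps (the several-variable Weierstrass `M`-test
`Literature.Analysis.Complex.SCV.analyticOnNhd_tsum_of_summable_norm`, with the uniform majorant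
`7(a+b+d+1)² p^{−3/2}` on all of `Ω₈`). [cite: GoldstonPintzYildirim2009, Section 9 eq. 9.17] -/
theorem differentiableOn_GStar₂ (h₀ : ℕ) (H₁ H₂ : Finset ℕ) :
    DifferentiableOn ℂ (fun z : ℂ × ℂ =>
      GStar h₀ H₁ H₂ (caseA h₀ H₁) (caseA h₀ H₂) (caseD h₀ H₁ H₂) z.1 z.2) GStarRegion := by
  have hdiff : DifferentiableOn ℂ (fun w : ℂ × ℂ =>
      (∏ p ∈ smallPrimes (starTailBound h₀ H₁ H₂),
          starGFactor h₀ H₁ H₂ (caseA h₀ H₁) (caseA h₀ H₂) (caseD h₀ H₁ H₂) p w.1 w.2) *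
        Complex.exp (∑' p : Nat.Primes, gStarTail h₀ H₁ H₂ p w.1 w.2)) GStarRegion := by
    refine DifferentiableOn.mul ?_ ?_
    · intro w hw
      classical
      have h := HasFDerivAt.finsetProd (u := smallPrimes (starTailBound h₀ H₁ H₂))
        (g := fun (p : Nat.Primes) (w : ℂ × ℂ) =>
          starGFactor h₀ H₁ H₂ (caseA h₀ H₁) (caseA h₀ H₂) (caseD h₀ H₁ H₂) p w.1 w.2) (x := w)
        (fun p _ => (differentiableAt_starGFactor₂ h₀ H₁ H₂ _ _ _ p.2.two_le
          (by have := hw.1; linarith) (by have := hw.2; linarith)).hasFDerivAt)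
      exact h.differentiableAt.differentiableWithinAt
    · exact (Literature.Analysis.Complex.SCV.analyticOnNhd_tsum_of_summable_norm isOpen_GStarRegion
        (fun p => differentiableOn_gStarTail₂ h₀ H₁ H₂ p) (summable_starTail_majorant h₀ H₁ H₂)
        (fun p w hw => norm_gStarTail_le (le_of_lt hw.1) (le_of_lt hw.2) p)).differentiableOn.cexp
  exact hdiff.congr fun w hw => GStar_eq_prod_mul_exp (le_of_lt hw.1) (le_of_lt hw.2)

/-- `G` is continuous on `Ω₈`. [cite: GoldstonPintzYildirim2009, Section 9 eq. 9.17] -/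
theorem continuousOn_GStar₂ (h₀ : ℕ) (H₁ H₂ : Finset ℕ) :
    ContinuousOn (fun z : ℂ × ℂ =>
      GStar h₀ H₁ H₂ (caseA h₀ H₁) (caseA h₀ H₂) (caseD h₀ H₁ H₂) z.1 z.2) GStarRegion :=
  (differentiableOn_GStar₂ h₀ H₁ H₂).continuousOn

/-- Slices: `G(·, s₂)` is holomorphic on `Re s₁ > −1/8` for `Re s₂ > −1/8`.
[cite: GoldstonPintzYildirim2009, Section 9 eq. 9.17] -/
theorem differentiableOn_GStar_fst (h₀ : ℕ) (H₁ H₂ : Finset ℕ) {s₂ : ℂ} (hs₂ : -1 / 8 < s₂.re) :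
    DifferentiableOn ℂ (fun s₁ : ℂ =>
      GStar h₀ H₁ H₂ (caseA h₀ H₁) (caseA h₀ H₂) (caseD h₀ H₁ H₂) s₁ s₂) {s₁ : ℂ | -1 / 8 < s₁.re} := by
  intro s₁ hs₁
  have h := (differentiableOn_GStar₂ h₀ H₁ H₂).differentiableAt (x := (s₁, s₂))
    (isOpen_GStarRegion.mem_nhds ⟨hs₁, hs₂⟩)
  have hi : DifferentiableAt ℂ (fun s : ℂ => (s, s₂)) s₁ :=
    differentiableAt_id.prodMk (differentiableAt_const _)
  exact (h.comp s₁ hi).differentiableWithinAt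

/-- Slices: `G(s₁, ·)` is holomorphic on `Re s₂ > −1/8` for `Re s₁ > −1/8`.
[cite: GoldstonPintzYildirim2009, Section 9 eq. 9.17] -/
theorem differentiableOn_GStar_snd (h₀ : ℕ) (H₁ H₂ : Finset ℕ) {s₁ : ℂ} (hs₁ : -1 / 8 < s₁.re) :
    DifferentiableOn ℂ (fun s₂ : ℂ =>
      GStar h₀ H₁ H₂ (caseA h₀ H₁) (caseA h₀ H₂) (caseD h₀ H₁ H₂) s₁ s₂) {s₂ : ℂ | -1 / 8 < s₂.re} := by
  intro s₂ hs₂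
  have h := (differentiableOn_GStar₂ h₀ H₁ H₂).differentiableAt (x := (s₁, s₂))
    (isOpen_GStarRegion.mem_nhds ⟨hs₁, hs₂⟩)
  have hi : DifferentiableAt ℂ (fun s : ℂ => (s₁, s)) s₂ :=
    (differentiableAt_const _).prodMk differentiableAt_id
  exact (h.comp s₂ hi).differentiableWithinAt

/-! ### Symmetry in `(s₁, a, H₁) ↔ (s₂, b, H₂)` -/

/-- `ν̄*` is symmetric in `H₁, H₂`. [folklore] -/
theorem nuBarStar_comm (h₀ : ℕ) (H₁ H₂ : Finset ℕ) (p : ℕ) :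
    nuBarStar h₀ H₁ H₂ p = nuBarStar h₀ H₂ H₁ p := by
  rw [nuBarStar, nuBarStar, nuBar_eq_card_inter, nuBar_eq_card_inter, Finset.inter_comm]

/-- `caseD` is symmetric. [folklore] -/
theorem caseD_comm (h₀ : ℕ) (H₁ H₂ : Finset ℕ) : caseD h₀ H₁ H₂ = caseD h₀ H₂ H₁ := by
  rw [caseD, caseD, Finset.inter_comm]

/-- The Euler factor of (9.16) is symmetric under `(s₁, H₁) ↔ (s₂, H₂)`. [folklore] -/
theorem starFactor_comm (h₀ : ℕ) (H₁ H₂ : Finset ℕ) (p : ℕ) (s₁ s₂ : ℂ) :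
    starFactor h₀ H₁ H₂ p s₁ s₂ = starFactor h₀ H₂ H₁ p s₂ s₁ := by
  rw [starFactor, starFactor, nuBarStar_comm, show s₂ + s₁ = s₁ + s₂ by ring]
  ring

/-- The factor of `G` is symmetric under `(s₁, a, H₁) ↔ (s₂, b, H₂)`. [folklore] -/
theorem starGFactor_comm (h₀ : ℕ) (H₁ H₂ : Finset ℕ) (a b d p : ℕ) (s₁ s₂ : ℂ) :
    starGFactor h₀ H₁ H₂ a b d p s₁ s₂ = starGFactor h₀ H₂ H₁ b a d p s₂ s₁ := by
  rw [starGFactor, starGFactor, starFactor_comm, show (-(1 + s₂ + s₁) : ℂ) = -(1 + s₁ + s₂) by ring]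
  ring

/-- `G` is symmetric under `(s₁, a, H₁) ↔ (s₂, b, H₂)`. [folklore] -/
theorem GStar_comm (h₀ : ℕ) (H₁ H₂ : Finset ℕ) (a b d : ℕ) (s₁ s₂ : ℂ) :
    GStar h₀ H₁ H₂ a b d s₁ s₂ = GStar h₀ H₂ H₁ b a d s₂ s₁ := by
  unfold GStar
  exact tprod_congr fun p => starGFactor_comm h₀ H₁ H₂ a b d p s₁ s₂

end Literature.NumberTheory.Sieve.GPY
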